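import Mathlib

/-!
# Imbrie (2016), Assumption LLA — XY rung: middle-vertex spectral coordinates of a 3-site Jacobi matrix (algebraic core)

CITATION HEADER (lean-in-tree rule 2026-08-18). J. Z. Imbrie, *On many-body localization for quantum spin chains*,
J. Stat. Phys. **163** (2016) 998–1048, doi 10.1007/s10955-016-1508-x, arXiv:1403.7837 [ImbrieJSP2016], eq. (1.3) (Assumption LLA(ν, C)) and
§4.2.1 (the level-attraction estimate it replaces).  Context: I. Dumitriu, A. Edelman, *Matrix models for beta ensembles*, J. Math. Phys. **43** (2002)
5830–5847, doi 10.1063/1.1507823, arXiv:math-ph/0206043, Lemmas 2.7, 2.9 (Jacobi matrix ↔ (spectrum, first-row weights), Jacobian ∏ b_i / ∏ q_i).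

WHAT IS PROVED (a lemma of the audit cell `pub-imbrie`, NOT a statement of the paper).  This is the kernel-checked algebra under the cell's
"level-density form of the XY rung" (pub-imbrie `b2b-imbrie-2/DENSITY-XY.md`, §4.1): for the free-fermion (XY) sibling of Imbrie's chain the n-site
block Hamiltonian is a Jacobi matrix `Jac(a, b)` (diagonal `a` = random fields, off-diagonal `b` = random couplings), and LLA-type bounds for its levels
follow from a bound on the density of the push-forward of Lebesgue measure `da db` under `(a, b) ↦ spectrum`.  For n = 3 that density is computed in the
coordinates (spectrum μ₁ < μ₂ < μ₃ of T, spectrum θ₁ < θ₂ of T with the MIDDLE vertex deleted = {a₁, a₃}), and the computation rests on three identities,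
all proved here by `ring`/`field_simp`:
* `jacobi3_det_sub` — the characteristic polynomial `det(T − z) = (a₂ − z)(a₁ − z)(a₃ − z) − b₁²(a₃ − z) − b₂²(a₁ − z)`, whence the residues
  `det(T − a₁) = b₁²(a₁ − a₃)`, `det(T − a₃) = b₂²(a₃ − a₁)` (`jacobi3_det_at_a₁`, `jacobi3_det_at_a₃`): the couplings are read off from the values of the
  characteristic polynomial at the levels of the vertex-deleted matrix;
* `jacobi3_middleVertex_reconstruct` — conversely, for θ₁ ≠ θ₂ and ANY μ, the matrix with end levels θ₁, θ₂, middle level Σμ − θ₁ − θ₂ and squared couplings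
  `B₁ = −P(θ₁)/(θ₂ − θ₁)`, `B₂ = P(θ₂)/(θ₂ − θ₁)`, `P(t) = ∏ (μ_i − t)`, has characteristic polynomial `P` (so (μ, θ, sheet) are coordinates: surjectivity),
  and under strict interlacing μ₁ < θ₁ < μ₂ < θ₂ < μ₃ both B's are positive (`interlacing3_couplingSq_pos`);
* `cauchy3_det` — the 3×3 Cauchy-type determinant `det[1,1,1; (μ_i − θ₁)⁻¹; (μ_i − θ₂)⁻¹] = Δ(μ)(θ₂ − θ₁)/∏_{i,j}(μ_i − θ_j)` with
  `Δ(μ) = (μ₁ − μ₂)(μ₁ − μ₃)(μ₂ − μ₃)`, which is the non-trivial minor of the Jacobian ∂(a, b)/∂(μ, θ) and gives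
  `|det ∂(a,b)/∂(μ,θ)| = |Δ(μ)| / (4 √(∏_{i,j} |μ_i − θ_j|))` (DENSITY-XY Prop. 2.2 at (n, v) = (3, 2); the calculus step is not formalised here).
STATUS: elementary algebra; it says NOTHING about whether LLA holds (OPEN, pub-imbrie LLA.md §7) — the analytic content (DENSITY-XY Thm 4.1,
sup of the 3-level density ≤ 32 + 48√2) is prose-proved in the cell folder only.  No `sorry`, no new axioms, no definitions.
-/

namespace Literature.MathematicalPhysics.QuantumLattice.Imbrie2016

/-- Characteristic polynomial of the 3-site Jacobi matrix `Jac((a₁,a₂,a₃),(b₁,b₂))`, evaluated at `z`.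
[cite: ImbrieJSP2016, §4.2.1; Dumitriu–Edelman 2002, Lemma 2.7] -/
theorem jacobi3_det_sub (a₁ a₂ a₃ b₁ b₂ z : ℝ) :
    Matrix.det !![a₁ - z, b₁, 0; b₁, a₂ - z, b₂; 0, b₂, a₃ - z]
      = (a₂ - z) * (a₁ - z) * (a₃ - z) - b₁ ^ 2 * (a₃ - z) - b₂ ^ 2 * (a₁ - z) := by
  rw [Matrix.det_fin_three]
  simp [Matrix.cons_val_zero, Matrix.cons_val_one]
  ring

/-- Residue at the left bare level: `det(T − a₁) = b₁² (a₁ − a₃)`, i.e. `b₁² = |det(T − a₁)| / |a₁ − a₃|`.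
[cite: ImbrieJSP2016, §4.2.1] -/
theorem jacobi3_det_at_a₁ (a₁ a₂ a₃ b₁ b₂ : ℝ) :
    Matrix.det !![a₁ - a₁, b₁, 0; b₁, a₂ - a₁, b₂; 0, b₂, a₃ - a₁] = b₁ ^ 2 * (a₁ - a₃) := by
  rw [jacobi3_det_sub]; ring

/-- Residue at the right bare level: `det(T − a₃) = b₂² (a₃ − a₁)`. [cite: ImbrieJSP2016, §4.2.1] -/
theorem jacobi3_det_at_a₃ (a₁ a₂ a₃ b₁ b₂ : ℝ) :
    Matrix.det !![a₁ - a₃, b₁, 0; b₁, a₂ - a₃, b₂; 0, b₂, a₃ - a₃] = b₂ ^ 2 * (a₃ - a₁) := by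
  rw [jacobi3_det_sub]; ring

/-- Middle-vertex reconstruction (surjectivity of the coordinates (μ, θ, sheet)): if `θ₁ ≠ θ₂`, `B₁ (θ₂ − θ₁) = −P(θ₁)` and `B₂ (θ₂ − θ₁) = P(θ₂)` with
`P(t) = (μ₁ − t)(μ₂ − t)(μ₃ − t)`, then the Jacobi-type matrix with diagonal `(θ₁, μ₁+μ₂+μ₃−θ₁−θ₂, θ₂)` and squared couplings `B₁, B₂` has
`det(T − z) = P(z)` for every `z` (stated on the expanded determinant of `jacobi3_det_sub`, with `bⱼ²` replaced by `Bⱼ`).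
[cite: ImbrieJSP2016, §4.2.1; Dumitriu–Edelman 2002, Lemma 2.5] -/
theorem jacobi3_middleVertex_reconstruct (μ₁ μ₂ μ₃ θ₁ θ₂ B₁ B₂ : ℝ) (hθ : θ₁ ≠ θ₂)
    (hB₁ : B₁ * (θ₂ - θ₁) = -((μ₁ - θ₁) * (μ₂ - θ₁) * (μ₃ - θ₁)))
    (hB₂ : B₂ * (θ₂ - θ₁) = (μ₁ - θ₂) * (μ₂ - θ₂) * (μ₃ - θ₂)) (z : ℝ) :
    ((μ₁ + μ₂ + μ₃ - θ₁ - θ₂) - z) * (θ₁ - z) * (θ₂ - z) - B₁ * (θ₂ - z) - B₂ * (θ₁ - z)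
      = (μ₁ - z) * (μ₂ - z) * (μ₃ - z) := by
  have hne : θ₂ - θ₁ ≠ 0 := sub_ne_zero.mpr (Ne.symm hθ)
  have key : (θ₂ - θ₁) * ((((μ₁ + μ₂ + μ₃ - θ₁ - θ₂) - z) * (θ₁ - z) * (θ₂ - z) - B₁ * (θ₂ - z) - B₂ * (θ₁ - z))
      - (μ₁ - z) * (μ₂ - z) * (μ₃ - z)) = 0 := by
    linear_combination (-(θ₂ - z)) * hB₁ + (-(θ₁ - z)) * hB₂
  have := (mul_eq_zero.mp key).resolve_left hne
  exact sub_eq_zero.mp this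

/-- Under strict interlacing `μ₁ < θ₁ < μ₂ < θ₂ < μ₃` the reconstructed squared couplings are positive:
`0 < −P(θ₁)/(θ₂ − θ₁)` and `0 < P(θ₂)/(θ₂ − θ₁)`. [cite: ImbrieJSP2016, §4.2.1] -/
theorem interlacing3_couplingSq_pos (μ₁ μ₂ μ₃ θ₁ θ₂ : ℝ) (h₁ : μ₁ < θ₁) (h₂ : θ₁ < μ₂) (h₃ : μ₂ < θ₂) (h₄ : θ₂ < μ₃) :
    0 < -((μ₁ - θ₁) * (μ₂ - θ₁) * (μ₃ - θ₁)) / (θ₂ - θ₁)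
      ∧ 0 < (μ₁ - θ₂) * (μ₂ - θ₂) * (μ₃ - θ₂) / (θ₂ - θ₁) := by
  have hθ : 0 < θ₂ - θ₁ := by linarith
  refine ⟨div_pos ?_ hθ, div_pos ?_ hθ⟩
  · have ha : 0 < θ₁ - μ₁ := by linarith
    have hb : 0 < μ₂ - θ₁ := by linarith
    have hc : 0 < μ₃ - θ₁ := by linarith
    have : -((μ₁ - θ₁) * (μ₂ - θ₁) * (μ₃ - θ₁)) = (θ₁ - μ₁) * (μ₂ - θ₁) * (μ₃ - θ₁) := by ring
    rw [this]; positivity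
  · have ha : 0 < θ₂ - μ₁ := by linarith
    have hb : 0 < θ₂ - μ₂ := by linarith
    have hc : 0 < μ₃ - θ₂ := by linarith
    have : (μ₁ - θ₂) * (μ₂ - θ₂) * (μ₃ - θ₂) = (θ₂ - μ₁) * (θ₂ - μ₂) * (μ₃ - θ₂) := by ring
    rw [this]; positivity

/-- The 3×3 Cauchy-type determinant behind the Jacobian of the middle-vertex coordinates:
`det[1,1,1; (μ_i − θ₁)⁻¹; (μ_i − θ₂)⁻¹] = (μ₁−μ₂)(μ₁−μ₃)(μ₂−μ₃)(θ₂−θ₁) / ∏_{i,j}(μ_i − θ_j)`.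
[cite: ImbrieJSP2016, §4.2.1; Dumitriu–Edelman 2002, Lemma 2.9] -/
theorem cauchy3_det (μ₁ μ₂ μ₃ θ₁ θ₂ : ℝ)
    (h₁₁ : μ₁ ≠ θ₁) (h₂₁ : μ₂ ≠ θ₁) (h₃₁ : μ₃ ≠ θ₁) (h₁₂ : μ₁ ≠ θ₂) (h₂₂ : μ₂ ≠ θ₂) (h₃₂ : μ₃ ≠ θ₂) :
    Matrix.det !![(1 : ℝ), 1, 1; (μ₁ - θ₁)⁻¹, (μ₂ - θ₁)⁻¹, (μ₃ - θ₁)⁻¹; (μ₁ - θ₂)⁻¹, (μ₂ - θ₂)⁻¹, (μ₃ - θ₂)⁻¹]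
      = (μ₁ - μ₂) * (μ₁ - μ₃) * (μ₂ - μ₃) * (θ₂ - θ₁)
        / ((μ₁ - θ₁) * (μ₂ - θ₁) * (μ₃ - θ₁) * (μ₁ - θ₂) * (μ₂ - θ₂) * (μ₃ - θ₂)) := by
  have g₁₁ : μ₁ - θ₁ ≠ 0 := sub_ne_zero.mpr h₁₁
  have g₂₁ : μ₂ - θ₁ ≠ 0 := sub_ne_zero.mpr h₂₁
  have g₃₁ : μ₃ - θ₁ ≠ 0 := sub_ne_zero.mpr h₃₁
  have g₁₂ : μ₁ - θ₂ ≠ 0 := sub_ne_zero.mpr h₁₂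
  have g₂₂ : μ₂ - θ₂ ≠ 0 := sub_ne_zero.mpr h₂₂
  have g₃₂ : μ₃ - θ₂ ≠ 0 := sub_ne_zero.mpr h₃₂
  rw [Matrix.det_fin_three]
  simp [Matrix.cons_val_zero, Matrix.cons_val_one]
  field_simp
  ring

end Literature.MathematicalPhysics.QuantumLattice.Imbrie2016
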